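/-
Copyright (c) 2026. All rights reserved.
Released under Apache 2.0 license as described in the file LICENSE.
-/
import Literature.Geometry.Kaehler.ComplexTorusQuaternionXSixStabilisers
import Literature.Geometry.Kaehler.ComplexTorusQuaternionLangOrderInMaximalOrder
import Literature.Geometry.Kaehler.ComplexTorusQuaternionUnitsModRamifiedPrimes
import HarnessLib

/-!
# Lang's curve over `X₆` on the special cycles: each `Γ₆`-class of `L(t)` is the union of the three `Γ`-classes
# `[x̂], [x̂^σ], [x̂^{σσ}]` (`Γ = 𝔬¹`, `σ = Ad(e²) = Ad(β)`), pairwise distinct unless the primitive norm is `3`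
# (Bayer–Travesa 2007 Thm. 1.1 read from Lang's curve; KRY (3.4.14) `e_x`; for `D(B) = 6`)

[tag: complex_torus] [tag: abelian_surface] [tag: quaternion_multiplication] [tag: complex_multiplication]
[tag: shimura_curve] [tag: special_cycles] [tag: cm_points] [tag: quaternion_order] [tag: covering]

Lane `lit-hodgefound`, seat p12, row g34-#8 — THEOREMS ONLY (no definition, no named fact, no instance); the UNIFORM form
of the instance-wise comparisons of g30-#4 `…LangOrderInMaximalOrder` (`O₆ = 𝔬 ⊔ 𝔬e² ⊔ 𝔬e²e²`, `[Γ₆ : Γ] = 3`; `P₃ ≡ P₅`,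
`P₆ ≢ P₅` on Bayer–Travesa's hexagon) and g30-#3 `…OrderThreeSymmetry` / `…XSixEllipticOrderThree` (`σ = ρ(β)`, `Ad(β)x = (x₀,
4x₁ − 6x₂ − 3x₃, −x₁ + 2x₂, −2x₁ + 3x₂ + 2x₃)`, `στ₃ ≅_ρ τ₃`), using g31-#8 `…XSixStabilisers` (the `Γ₆`-stabilisers of special
vectors: `{±1}`, `ℤ[i]^×`, or `ℤ[ζ₃]^× ∌ (1 ± p̂)/2 ∉ 𝔬`). Setting as there: `B = (−1,3)_ℚ` (`D(B) = 6`), Lang's order `𝔬 =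
ℤ⟨1, i, j, ij⟩` with unit group `Γ = 𝔬¹` (`v ∈ 𝔬`, `nr v = (vv̄)₀ = 1`; Lang's curve is `Γ∖𝔥`), the maximal order `O₆ ∋ e =
(1 + i + j − ij)/2` (the predicate `x ∈ 𝔬 ∨ x − e ∈ 𝔬`) with `Γ₆ = O₆¹` (`X₆ = Γ₆∖𝔥`), the norm-one unit `e² = e + 1 = (3 + i
+ j − ij)/2 = β/2` of `O₆` (`e² ∉ 𝔬`), special vectors `x̂ = x₁i + x₂j + x₃ij ∈ 𝔬` (integer triples), `Q(x) = x₁² − 3x₂² −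
3x₃²`, `L(t) = {x̂ : Q = t}`; «`g` conjugates `x̂` to `ẑ`» is `g·x̂ = ẑ·g`. The images of `x̂` under `σ = Ad(e²)` and `σσ`:
`x̂^σ = (4x₁ − 6x₂ − 3x₃)i + (−x₁ + 2x₂)j + (−2x₁ + 3x₂ + 2x₃)ij`, `x̂^{σσ} = (x̂^σ)^σ = (28x₁ − 45x₂ − 18x₃)i + (−6x₁ + 10x₂
+ 3x₃)j + (−15x₁ + 24x₂ + 10x₃)ij`, both in `L(Q(x))`.

## The print, VERBATIM

* P. Bayer, A. Travesa (2007) [BayerTravesa2007] §1: «`O₆ := ℤ[1, I, J, (1 + I + J + K)/2]` … `Γ₆ = {γ ∈ O₆ : n(γ) = 1}`»;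
  Thm. 1.1: «The vertices `P₁ ≡ P₃ ≡ P₅ (mod Γ₆)` and `P₆` are elliptic of order `2`; the remaining vertices `P₂, P₄` are
  elliptic of order `3`.» (the identifications `P₃ ≡ P₅` are by units of `O₆ ∖ 𝔬` — g30-#4 `u = −ie²`).
* S. Kudla, M. Rapoport, T. Yang (2006) [KudlaRapoportYang2006] §3.4 (3.4.14): «`deg 𝒵(t)_ℚ = 2 Σ_{x ∈ L(t) mod Γ} e_x⁻¹`»
  (`e_x` the order of the stabiliser `Γ_x`); (3.4.6) «`w(c²d)` is the number of units in `O_{c²d}`».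
* S. Lang (1982) [Lang1982AbelianFunctions] Ch. IX §4 (the order `𝔬 = ℤ⟨1, i, j, ij⟩` of `(−1,3)_ℚ` and its unit group),
  §5 («units of norm `−1`»; the curve `Γ∖𝔥`).

Reading: `Γ = 𝔬¹` has index `3` in `Γ₆` and is NORMAL (`e²` normalises `𝔬`, g30-#3 `exists_beta_mul_eq`), with `Γ₆ = Γ ⊔
Γe² ⊔ Γe²e²`; hence on `L(t)` every `Γ₆`-orbit is the union of the `Γ`-orbits of `x̂`, `e²x̂ē² = x̂^σ`, `e²e²x̂ē²ē² = x̂^{σσ}`,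
and `Γx̂^{σᵏ} = Γx̂` iff the coset `Γe^{2k}` meets the stabiliser `(Γ₆)_x̂`: never if `(Γ₆)_x̂ ⊂ 𝔬` (`e_x ∈ {2, 4}`: three
sheets of Lang's curve over the point of `Z(t)`), always if `(Γ₆)_x̂ = ℤ[ζ₃]^×` (`e_x = 6`, the `Z(3)`-points: one sheet,
ramification index `3`).

## What is proved (all for `D(B) = 6`, explicitly)

* §1 `σ` ON SPECIAL VECTORS: **`e²·x̂ = x̂^σ·e²`** (`e_sq_mul_pureVec`, from g30-#3 `beta_mul_eq_ad_mul_beta` and `β = 2e²`),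
  `ē²·x̂^σ = x̂·ē²` (`star_e_sq_mul_pureVec`), **`e²e²·x̂ = x̂^{σσ}·e²e²`** (`e_sq_e_sq_mul_pureVec`), `Q(x̂^σ) = Q(x̂^{σσ}) =
  Q(x̂)` (`specialNorm_sigma_sigma`, with g30-#3 `specialNorm_ad_beta`); `e², ē², e²e², ē²ē² ∉ 𝔬`
  (`e_sq_not_mem_order` …); and **`Γ₆ = Γ ∪ Γe² ∪ Γe²e²` with norms** (`exists_order_normOne_mul_e_pow`, from g30-#4
  `exists_order_mul_e_pow`).
* §2 **`Γ₆`-CONJUGACY = `Γ`-CONJUGACY OF ONE OF `x̂, x̂^σ, x̂^{σσ}`** (`maxOrder_normOne_conj_iff_order`): `∃ u ∈ Γ₆, u·x̂ =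
  ẑ·u ⟺ (∃ v ∈ Γ, v·x̂ = ẑ·v) ∨ (∃ v ∈ Γ, v·x̂^σ = ẑ·v) ∨ (∃ v ∈ Γ, v·x̂^{σσ} = ẑ·v)`.
* §3 **THREE SHEETS: if every `w ∈ Γ₆` commuting with `x̂` lies in `𝔬`, then `x̂, x̂^σ, x̂^{σσ}` are PAIRWISE NOT
  `Γ`-CONJUGATE** (`sigma_classes_pairwise_not_order_conj`: a `v ∈ Γ` with `v·x̂ = x̂^σ·v` would put `ē²v` in the
  stabiliser, forcing `ē² ∈ 𝔬`; the pair `(x̂^σ, x̂^{σσ})` is carried back to `(x̂, x̂^σ)` by `Ad(ē²)`, which preserves `Γ` —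
  g30-#3 `exists_mul_beta_eq`).
* §4 WHICH VECTORS: **the hypothesis of §3 holds for every `x̂ = c·p̂`, `c ∈ ℤ ∖ {0}`, `p̂` primitive with `Q(p̂) > 0`,
  `Q(p̂) ≠ 3`** (`stabiliser_subset_order_of_primitive_norm_ne_three`, from g31-#8: the stabiliser is `{±1}` or, for `Q(p̂) = 1`,
  `{±1, ±p̂} ⊂ 𝔬`), so **`|Γ∖(Γ₆·x̂)| = 3`** there (`three_sheets_of_primitive_norm_ne_three`); and **for `Q(p̂) = 3` the three
  `Γ`-classes MERGE** (`sigma_classes_merge_of_norm_three`: `s = (1 + p̂)/2 ∈ Γ₆ ∖ 𝔬` commutes with `p̂` and lies in `Γe²`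
  or `Γe²e²`, and so does `s̄`; whence `v·x̂^σ = x̂·v` and `v'·x̂^{σσ} = x̂·v'` for some `v, v' ∈ Γ`) — over the `Z(3)`-points
  (the order-`3` elliptic points `P₂, P₄` of `X₆`) Lang's curve has ONE point, over every other CM point of a special
  cycle THREE.

## Honest scope

No quotient, covering map or ramification index is formed: «three sheets» is §2 + §3 (union of three pairwise distinct
`Γ`-classes), «one sheet» is §2 + §4 (the three classes coincide); only CM points of special cycles (`Q > 0`) are treated,
not arbitrary points of `X₆`; the identification of `Γ∖𝔥`, `Γ₆∖𝔥` with Lang's curve and `X₆` is that of g30-#4 and is not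
re-proved. 0 definitions, 0 named facts, 0 instances — net debt `0`.

## References
* [BayerTravesa2007] P. Bayer, A. Travesa, *Uniformizing functions for certain Shimura curves, in the case D = 6*, Acta
  Arith. 126 (2007), §1 Thm. 1.1, Table 1.
* [KudlaRapoportYang2006] S. Kudla, M. Rapoport, T. Yang, *Modular Forms and Special Cycles on Shimura Curves*, Ann. of
  Math. Stud. 161 (2006), §3.4 (3.4.6), (3.4.8), (3.4.14).
* [Lang1982AbelianFunctions] S. Lang, *Introduction to Algebraic and Abelian Functions*, 2nd ed. (1982), Ch. IX §4–§5.
-/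

noncomputable section

set_option maxSynthPendingDepth 3

open Quaternion Function

namespace Literature.Geometry.Kaehler.ComplexTorus.QuaternionType

/-! ## §1 `σ = Ad(e²)` on special vectors; the cosets `Γ, Γe², Γe²e²` -/

section Sigma

/-- **`e²·x̂ = x̂^σ·e²` with `x̂^σ = (4x₁ − 6x₂ − 3x₃)i + (−x₁ + 2x₂)j + (−2x₁ + 3x₂ + 2x₃)ij`** — the pure-vector case of
g30-#3's `Ad(β)` (`beta_mul_eq_ad_mul_beta`), since `β = 3 + i + j − ij = 2e²` (`beta_eq_two_smul_e_sq`). [cite: BayerTravesa2007, §1 («`Γ₆ = {γ ∈ O₆ : n(γ) = 1}`»)] [cite: Lang1982AbelianFunctions, Ch. IX §4] -/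
theorem e_sq_mul_pureVec (x₁ x₂ x₃ : ℚ) :
    (⟨1/2, 1/2, 1/2, -1/2⟩ : ℍ[ℚ,((-1 : ℤ) : ℚ),((3 : ℤ) : ℚ)]) * ⟨1/2, 1/2, 1/2, -1/2⟩ * ⟨0, x₁, x₂, x₃⟩
      = ⟨0, 4 * x₁ - 6 * x₂ - 3 * x₃, -x₁ + 2 * x₂, -2 * x₁ + 3 * x₂ + 2 * x₃⟩ *
          ((⟨1/2, 1/2, 1/2, -1/2⟩ : ℍ[ℚ,((-1 : ℤ) : ℚ),((3 : ℤ) : ℚ)]) * ⟨1/2, 1/2, 1/2, -1/2⟩) := by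
  have h := beta_mul_eq_ad_mul_beta (⟨0, x₁, x₂, x₃⟩ : ℍ[ℚ,((-1 : ℤ) : ℚ),((3 : ℤ) : ℚ)])
  rw [beta_eq_two_smul_e_sq, smul_mul_assoc, mul_smul_comm] at h
  have h2 := smul_right_injective _ (two_ne_zero (α := ℚ)) h
  dsimp only at h2
  convert h2 using 2

/-- `e²ē² = 1`, `ē²e² = 1`: `e²` as a unit. [cite: BayerTravesa2007, §1] -/
private theorem isUnit_e_sq :
    IsUnit ((⟨1/2, 1/2, 1/2, -1/2⟩ : ℍ[ℚ,((-1 : ℤ) : ℚ),((3 : ℤ) : ℚ)]) * ⟨1/2, 1/2, 1/2, -1/2⟩) :=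
  ⟨⟨_, _, e_sq_mul_star_and.1, e_sq_mul_star_and.2⟩, rfl⟩

/-- **`ē²·x̂^σ = x̂·ē²`** (`Ad(ē²) = σ⁻¹`). [cite: BayerTravesa2007, §1] [cite: Lang1982AbelianFunctions, Ch. IX §4] -/
theorem star_e_sq_mul_pureVec (x₁ x₂ x₃ : ℚ) :
    star ((⟨1/2, 1/2, 1/2, -1/2⟩ : ℍ[ℚ,((-1 : ℤ) : ℚ),((3 : ℤ) : ℚ)]) * ⟨1/2, 1/2, 1/2, -1/2⟩) *
        ⟨0, 4 * x₁ - 6 * x₂ - 3 * x₃, -x₁ + 2 * x₂, -2 * x₁ + 3 * x₂ + 2 * x₃⟩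
      = ⟨0, x₁, x₂, x₃⟩ * star ((⟨1/2, 1/2, 1/2, -1/2⟩ : ℍ[ℚ,((-1 : ℤ) : ℚ),((3 : ℤ) : ℚ)]) * ⟨1/2, 1/2, 1/2, -1/2⟩) := by
  set E2 := (⟨1/2, 1/2, 1/2, -1/2⟩ : ℍ[ℚ,((-1 : ℤ) : ℚ),((3 : ℤ) : ℚ)]) * ⟨1/2, 1/2, 1/2, -1/2⟩ with hE2
  have h := e_sq_mul_pureVec x₁ x₂ x₃
  rw [← hE2] at h
  calc star E2 * ⟨0, 4 * x₁ - 6 * x₂ - 3 * x₃, -x₁ + 2 * x₂, -2 * x₁ + 3 * x₂ + 2 * x₃⟩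
      = star E2 * ⟨0, 4 * x₁ - 6 * x₂ - 3 * x₃, -x₁ + 2 * x₂, -2 * x₁ + 3 * x₂ + 2 * x₃⟩ * (E2 * star E2) := by
        rw [hE2, e_sq_mul_star_and.1, mul_one]
    _ = star E2 * (⟨0, 4 * x₁ - 6 * x₂ - 3 * x₃, -x₁ + 2 * x₂, -2 * x₁ + 3 * x₂ + 2 * x₃⟩ * E2) * star E2 := by
        simp only [mul_assoc]
    _ = star E2 * (E2 * ⟨0, x₁, x₂, x₃⟩) * star E2 := by rw [← h]
    _ = (star E2 * E2) * ⟨0, x₁, x₂, x₃⟩ * star E2 := by simp only [mul_assoc]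
    _ = ⟨0, x₁, x₂, x₃⟩ * star E2 := by rw [hE2, e_sq_mul_star_and.2, one_mul]

/-- `σ` applied to the `σ`-coordinates gives the `σσ`-coordinates. [folklore] -/
private theorem sigma_sigma_coords (x₁ x₂ x₃ : ℚ) :
    (⟨0, 4 * (4 * x₁ - 6 * x₂ - 3 * x₃) - 6 * (-x₁ + 2 * x₂) - 3 * (-2 * x₁ + 3 * x₂ + 2 * x₃),
      -(4 * x₁ - 6 * x₂ - 3 * x₃) + 2 * (-x₁ + 2 * x₂),
      -2 * (4 * x₁ - 6 * x₂ - 3 * x₃) + 3 * (-x₁ + 2 * x₂) + 2 * (-2 * x₁ + 3 * x₂ + 2 * x₃)⟩ :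
        ℍ[ℚ,((-1 : ℤ) : ℚ),((3 : ℤ) : ℚ)])
      = ⟨0, 28 * x₁ - 45 * x₂ - 18 * x₃, -6 * x₁ + 10 * x₂ + 3 * x₃, -15 * x₁ + 24 * x₂ + 10 * x₃⟩ := by
  ext <;> dsimp only <;> ring

/-- **`ē²·x̂^{σσ} = x̂^σ·ē²`.** [cite: BayerTravesa2007, §1] [cite: Lang1982AbelianFunctions, Ch. IX §4] -/
theorem star_e_sq_mul_pureVec_sigma (x₁ x₂ x₃ : ℚ) :
    star ((⟨1/2, 1/2, 1/2, -1/2⟩ : ℍ[ℚ,((-1 : ℤ) : ℚ),((3 : ℤ) : ℚ)]) * ⟨1/2, 1/2, 1/2, -1/2⟩) *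
        ⟨0, 28 * x₁ - 45 * x₂ - 18 * x₃, -6 * x₁ + 10 * x₂ + 3 * x₃, -15 * x₁ + 24 * x₂ + 10 * x₃⟩
      = ⟨0, 4 * x₁ - 6 * x₂ - 3 * x₃, -x₁ + 2 * x₂, -2 * x₁ + 3 * x₂ + 2 * x₃⟩ *
          star ((⟨1/2, 1/2, 1/2, -1/2⟩ : ℍ[ℚ,((-1 : ℤ) : ℚ),((3 : ℤ) : ℚ)]) * ⟨1/2, 1/2, 1/2, -1/2⟩) := by
  rw [← sigma_sigma_coords]
  exact star_e_sq_mul_pureVec _ _ _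

/-- **`e²e²·x̂ = x̂^{σσ}·e²e²`** with `x̂^{σσ} = (28x₁ − 45x₂ − 18x₃)i + (−6x₁ + 10x₂ + 3x₃)j + (−15x₁ + 24x₂ + 10x₃)ij`
(`σ` applied twice). [cite: BayerTravesa2007, §1] [cite: Lang1982AbelianFunctions, Ch. IX §4] -/
theorem e_sq_e_sq_mul_pureVec (x₁ x₂ x₃ : ℚ) :
    (⟨1/2, 1/2, 1/2, -1/2⟩ : ℍ[ℚ,((-1 : ℤ) : ℚ),((3 : ℤ) : ℚ)]) * ⟨1/2, 1/2, 1/2, -1/2⟩ *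
          ((⟨1/2, 1/2, 1/2, -1/2⟩ : ℍ[ℚ,((-1 : ℤ) : ℚ),((3 : ℤ) : ℚ)]) * ⟨1/2, 1/2, 1/2, -1/2⟩) * ⟨0, x₁, x₂, x₃⟩
      = ⟨0, 28 * x₁ - 45 * x₂ - 18 * x₃, -6 * x₁ + 10 * x₂ + 3 * x₃, -15 * x₁ + 24 * x₂ + 10 * x₃⟩ *
          ((⟨1/2, 1/2, 1/2, -1/2⟩ : ℍ[ℚ,((-1 : ℤ) : ℚ),((3 : ℤ) : ℚ)]) * ⟨1/2, 1/2, 1/2, -1/2⟩ *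
            ((⟨1/2, 1/2, 1/2, -1/2⟩ : ℍ[ℚ,((-1 : ℤ) : ℚ),((3 : ℤ) : ℚ)]) * ⟨1/2, 1/2, 1/2, -1/2⟩)) := by
  set E2 := (⟨1/2, 1/2, 1/2, -1/2⟩ : ℍ[ℚ,((-1 : ℤ) : ℚ),((3 : ℤ) : ℚ)]) * ⟨1/2, 1/2, 1/2, -1/2⟩ with hE2
  have h1 := e_sq_mul_pureVec x₁ x₂ x₃
  have h2 := e_sq_mul_pureVec (4 * x₁ - 6 * x₂ - 3 * x₃) (-x₁ + 2 * x₂) (-2 * x₁ + 3 * x₂ + 2 * x₃)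
  rw [← hE2] at h1 h2
  have e := sigma_sigma_coords x₁ x₂ x₃
  calc E2 * E2 * ⟨0, x₁, x₂, x₃⟩ = E2 * (E2 * ⟨0, x₁, x₂, x₃⟩) := mul_assoc _ _ _
    _ = E2 * (⟨0, 4 * x₁ - 6 * x₂ - 3 * x₃, -x₁ + 2 * x₂, -2 * x₁ + 3 * x₂ + 2 * x₃⟩ * E2) := by rw [h1]
    _ = E2 * ⟨0, 4 * x₁ - 6 * x₂ - 3 * x₃, -x₁ + 2 * x₂, -2 * x₁ + 3 * x₂ + 2 * x₃⟩ * E2 := (mul_assoc _ _ _).symm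
    _ = ⟨0, 28 * x₁ - 45 * x₂ - 18 * x₃, -6 * x₁ + 10 * x₂ + 3 * x₃, -15 * x₁ + 24 * x₂ + 10 * x₃⟩ * E2 * E2 := by
        rw [h2, e]
    _ = ⟨0, 28 * x₁ - 45 * x₂ - 18 * x₃, -6 * x₁ + 10 * x₂ + 3 * x₃, -15 * x₁ + 24 * x₂ + 10 * x₃⟩ * (E2 * E2) :=
        mul_assoc _ _ _

/-- **`Q(x̂^{σσ}) = Q(x̂)`** (and `Q(x̂^σ) = Q(x̂)`, g30-#3 `specialNorm_ad_beta`): `σ` permutes each `L(t)`. [cite: KudlaRapoportYang2006, §3.4 (3.4.8)] -/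
theorem specialNorm_sigma_sigma {R : Type*} [CommRing R] (x₁ x₂ x₃ : R) :
    (28 * x₁ - 45 * x₂ - 18 * x₃) ^ 2 - 3 * (-6 * x₁ + 10 * x₂ + 3 * x₃) ^ 2 - 3 * (-15 * x₁ + 24 * x₂ + 10 * x₃) ^ 2
      = x₁ ^ 2 - 3 * x₂ ^ 2 - 3 * x₃ ^ 2 := by
  ring

/-- **`e², ē², e²e², ē²ē² ∉ 𝔬`**: the cosets `Γe²`, `Γe²e²` are not `Γ` — the tree's `order_unit_mul_e_sq_not_mem_order`
(g33 `…UnitsModRamifiedPrimes`, at `v = 1`) and `star`-closure of `𝔬`. [cite: BayerTravesa2007, §1] [cite: Lang1982AbelianFunctions, Ch. IX §4 Thm. 4.2] -/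
private theorem e_sq_not_mem_order' :
    (⟨1/2, 1/2, 1/2, -1/2⟩ : ℍ[ℚ,((-1 : ℤ) : ℚ),((3 : ℤ) : ℚ)]) * ⟨1/2, 1/2, 1/2, -1/2⟩ ∉ order (-1) 3 ∧
    star ((⟨1/2, 1/2, 1/2, -1/2⟩ : ℍ[ℚ,((-1 : ℤ) : ℚ),((3 : ℤ) : ℚ)]) * ⟨1/2, 1/2, 1/2, -1/2⟩) ∉ order (-1) 3 ∧
    (⟨1/2, 1/2, 1/2, -1/2⟩ : ℍ[ℚ,((-1 : ℤ) : ℚ),((3 : ℤ) : ℚ)]) * ⟨1/2, 1/2, 1/2, -1/2⟩ *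
        ((⟨1/2, 1/2, 1/2, -1/2⟩ : ℍ[ℚ,((-1 : ℤ) : ℚ),((3 : ℤ) : ℚ)]) * ⟨1/2, 1/2, 1/2, -1/2⟩) ∉ order (-1) 3 ∧
    star ((⟨1/2, 1/2, 1/2, -1/2⟩ : ℍ[ℚ,((-1 : ℤ) : ℚ),((3 : ℤ) : ℚ)]) * ⟨1/2, 1/2, 1/2, -1/2⟩ *
        ((⟨1/2, 1/2, 1/2, -1/2⟩ : ℍ[ℚ,((-1 : ℤ) : ℚ),((3 : ℤ) : ℚ)]) * ⟨1/2, 1/2, 1/2, -1/2⟩)) ∉ order (-1) 3 := by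
  obtain ⟨h2, h4⟩ := order_unit_mul_e_sq_not_mem_order (v := 1) (Subring.one_mem _)
    (Or.inl (by rw [one_mul, star_one, QuaternionAlgebra.re_one]))
  rw [one_mul] at h2 h4
  refine ⟨h2, fun h ↦ h2 ?_, h4, fun h ↦ h4 ?_⟩
  · have h' := star_mem_order h
    rwa [star_star] at h'
  · have h' := star_mem_order h
    rwa [star_star] at h'

/-- `e ∈ O₆` and `e² ∈ O₆`. [cite: BayerTravesa2007, §1] -/
private theorem e_sq_maxOrder :
    ((⟨1/2, 1/2, 1/2, -1/2⟩ : ℍ[ℚ,((-1 : ℤ) : ℚ),((3 : ℤ) : ℚ)]) * ⟨1/2, 1/2, 1/2, -1/2⟩ ∈ order (-1) 3 ∨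
      (⟨1/2, 1/2, 1/2, -1/2⟩ : ℍ[ℚ,((-1 : ℤ) : ℚ),((3 : ℤ) : ℚ)]) * ⟨1/2, 1/2, 1/2, -1/2⟩ - ⟨1/2, 1/2, 1/2, -1/2⟩
        ∈ order (-1) 3) := by
  have hE : (⟨1/2, 1/2, 1/2, -1/2⟩ : ℍ[ℚ,((-1 : ℤ) : ℚ),((3 : ℤ) : ℚ)]) ∈ order (-1) 3 ∨
      (⟨1/2, 1/2, 1/2, -1/2⟩ : ℍ[ℚ,((-1 : ℤ) : ℚ),((3 : ℤ) : ℚ)]) - ⟨1/2, 1/2, 1/2, -1/2⟩ ∈ order (-1) 3 :=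
    Or.inr (by rw [sub_self]; exact zero_mem _)
  exact maxOrder_mul hE hE

/-- **`Γ₆ = Γ ∪ Γe² ∪ Γe²e²`**: every `u ∈ O₆` with `nr u = 1` is `v`, `ve²` or `ve²e²` with `v ∈ 𝔬`, `nr v = 1` (g30-#4
`exists_order_mul_e_pow`, norms by `mul_e_sq_mul_star`) — `[Γ₆ : Γ] = 3`. [cite: BayerTravesa2007, §1 Thm. 1.1 («`P₁ ≡ P₃ ≡ P₅ (mod Γ₆)`»)] [cite: Lang1982AbelianFunctions, Ch. IX §5] -/
theorem exists_order_normOne_mul_e_pow {u : ℍ[ℚ,((-1 : ℤ) : ℚ),((3 : ℤ) : ℚ)]}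
    (hu : u ∈ order (-1) 3 ∨ u - ⟨1/2, 1/2, 1/2, -1/2⟩ ∈ order (-1) 3) (hn : (u * star u).re = 1) :
    ∃ v ∈ order (-1) 3, (v * star v).re = 1 ∧ (u = v ∨
      u = v * ((⟨1/2, 1/2, 1/2, -1/2⟩ : ℍ[ℚ,((-1 : ℤ) : ℚ),((3 : ℤ) : ℚ)]) * ⟨1/2, 1/2, 1/2, -1/2⟩) ∨
      u = v * ((⟨1/2, 1/2, 1/2, -1/2⟩ : ℍ[ℚ,((-1 : ℤ) : ℚ),((3 : ℤ) : ℚ)]) * ⟨1/2, 1/2, 1/2, -1/2⟩) *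
        ((⟨1/2, 1/2, 1/2, -1/2⟩ : ℍ[ℚ,((-1 : ℤ) : ℚ),((3 : ℤ) : ℚ)]) * ⟨1/2, 1/2, 1/2, -1/2⟩)) := by
  obtain ⟨v, hv, h⟩ := exists_order_mul_e_pow hu
  refine ⟨v, hv, ?_, h⟩
  rcases h with rfl | rfl | rfl
  · exact hn
  · rwa [mul_e_sq_mul_star] at hn
  · rwa [mul_e_sq_mul_star, mul_e_sq_mul_star] at hn

end Sigma

/-! ## §2 `Γ₆`-conjugacy = `Γ`-conjugacy of one of `x̂, x̂^σ, x̂^{σσ}` -/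

section Classes

/-- **`Γ₆`-CONJUGACY IS `Γ`-CONJUGACY OF `x̂`, `x̂^σ` OR `x̂^{σσ}`**: for an integer triple `x` and any `Ẑ`, `∃ u ∈ Γ₆ = O₆¹`
with `u·x̂ = Ẑ·u` iff some `v ∈ Γ = 𝔬¹` has `v·x̂ = Ẑ·v`, or `v·x̂^σ = Ẑ·v`, or `v·x̂^{σσ} = Ẑ·v` (`u = v`, `ve²`, `ve²e²`
and `e²x̂ = x̂^σe²`): the `Γ₆`-class of a special vector is the union of the `Γ`-classes of `x̂, x̂^σ, x̂^{σσ}` — the fibre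
of Lang's curve over the point of `Z(t)` on `X₆`. [cite: BayerTravesa2007, §1 Thm. 1.1 («`P₁ ≡ P₃ ≡ P₅ (mod Γ₆)`») and Table 1] [cite: KudlaRapoportYang2006, §3.4 (3.4.14) («`x ∈ L(t) mod Γ`»)] [cite: Lang1982AbelianFunctions, Ch. IX §5] -/
theorem maxOrder_normOne_conj_iff_order (x : Fin 3 → ℤ) (Z : ℍ[ℚ,((-1 : ℤ) : ℚ),((3 : ℤ) : ℚ)]) :
    (∃ u : ℍ[ℚ,((-1 : ℤ) : ℚ),((3 : ℤ) : ℚ)], (u ∈ order (-1) 3 ∨ u - ⟨1/2, 1/2, 1/2, -1/2⟩ ∈ order (-1) 3) ∧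
        (u * star u).re = 1 ∧ u * ⟨0, x 0, x 1, x 2⟩ = Z * u) ↔
      (∃ v ∈ order (-1) 3, (v * star v).re = 1 ∧ v * ⟨0, x 0, x 1, x 2⟩ = Z * v) ∨
      (∃ v ∈ order (-1) 3, (v * star v).re = 1 ∧
        v * ⟨0, 4 * x 0 - 6 * x 1 - 3 * x 2, -x 0 + 2 * x 1, -2 * x 0 + 3 * x 1 + 2 * x 2⟩ = Z * v) ∨
      (∃ v ∈ order (-1) 3, (v * star v).re = 1 ∧
        v * ⟨0, 28 * x 0 - 45 * x 1 - 18 * x 2, -6 * x 0 + 10 * x 1 + 3 * x 2, -15 * x 0 + 24 * x 1 + 10 * x 2⟩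
          = Z * v) := by
  set E2 := (⟨1/2, 1/2, 1/2, -1/2⟩ : ℍ[ℚ,((-1 : ℤ) : ℚ),((3 : ℤ) : ℚ)]) * ⟨1/2, 1/2, 1/2, -1/2⟩ with hE2
  have h1 : E2 * ⟨0, x 0, x 1, x 2⟩ = ⟨0, 4 * x 0 - 6 * x 1 - 3 * x 2, -x 0 + 2 * x 1, -2 * x 0 + 3 * x 1 + 2 * x 2⟩ * E2 := by
    rw [hE2]; exact e_sq_mul_pureVec _ _ _
  have h2 : E2 * E2 * ⟨0, x 0, x 1, x 2⟩
      = ⟨0, 28 * x 0 - 45 * x 1 - 18 * x 2, -6 * x 0 + 10 * x 1 + 3 * x 2, -15 * x 0 + 24 * x 1 + 10 * x 2⟩ * (E2 * E2) := by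
    rw [hE2]; exact e_sq_e_sq_mul_pureVec _ _ _
  have hU : IsUnit E2 := by rw [hE2]; exact isUnit_e_sq
  have hO : E2 ∈ order (-1) 3 ∨ E2 - ⟨1/2, 1/2, 1/2, -1/2⟩ ∈ order (-1) 3 := by rw [hE2]; exact e_sq_maxOrder
  have hn2 : ∀ w : ℍ[ℚ,((-1 : ℤ) : ℚ),((3 : ℤ) : ℚ)], (w * E2 * star (w * E2)).re = (w * star w).re := fun w ↦ by
    rw [hE2, mul_e_sq_mul_star]
  constructor
  · rintro ⟨u, hu, hn, h⟩
    obtain ⟨v, hv, hvn, hu'⟩ := exists_order_normOne_mul_e_pow hu hn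
    rw [← hE2] at hu'
    rcases hu' with hu' | hu' | hu' <;> rw [hu'] at h
    · exact Or.inl ⟨v, hv, hvn, h⟩
    · refine Or.inr (Or.inl ⟨v, hv, hvn, hU.mul_right_cancel ?_⟩)
      rw [mul_assoc, h1, ← mul_assoc] at h
      rw [h, mul_assoc]
    · refine Or.inr (Or.inr ⟨v, hv, hvn, (hU.mul hU).mul_right_cancel ?_⟩)
      rw [mul_assoc v, mul_assoc v, h2, ← mul_assoc v] at h
      rw [h, mul_assoc Z, mul_assoc]
  · rintro (⟨v, hv, hvn, h⟩ | ⟨v, hv, hvn, h⟩ | ⟨v, hv, hvn, h⟩)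
    · exact ⟨v, Or.inl hv, hvn, h⟩
    · refine ⟨v * E2, maxOrder_mul (Or.inl hv) hO, by rw [hn2]; exact hvn, ?_⟩
      rw [mul_assoc, h1, ← mul_assoc, h, mul_assoc]
    · refine ⟨v * E2 * E2, maxOrder_mul (maxOrder_mul (Or.inl hv) hO) hO, by rw [hn2, hn2]; exact hvn, ?_⟩
      rw [mul_assoc v, mul_assoc v, h2, ← mul_assoc v, h, mul_assoc Z, mul_assoc]

end Classes

/-! ## §3 Three sheets: `x̂, x̂^σ, x̂^{σσ}` pairwise not `Γ`-conjugate when the stabiliser lies in `𝔬` -/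

section Sheets

/-- `Ad(ē²)` preserves `𝔬`: `ē²ve² ∈ 𝔬` for `v ∈ 𝔬` (g30-#3 `exists_mul_beta_eq`, `β = 2e²`). [cite: Lang1982AbelianFunctions, Ch. IX §4] -/
private theorem star_e_sq_mul_mul_e_sq_mem_order {v : ℍ[ℚ,((-1 : ℤ) : ℚ),((3 : ℤ) : ℚ)]} (hv : v ∈ order (-1) 3) :
    star ((⟨1/2, 1/2, 1/2, -1/2⟩ : ℍ[ℚ,((-1 : ℤ) : ℚ),((3 : ℤ) : ℚ)]) * ⟨1/2, 1/2, 1/2, -1/2⟩) * v *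
        ((⟨1/2, 1/2, 1/2, -1/2⟩ : ℍ[ℚ,((-1 : ℤ) : ℚ),((3 : ℤ) : ℚ)]) * ⟨1/2, 1/2, 1/2, -1/2⟩) ∈ order (-1) 3 := by
  obtain ⟨x', hx', h⟩ := exists_mul_beta_eq hv
  rw [beta_eq_two_smul_e_sq, mul_smul_comm, smul_mul_assoc] at h
  have h2 := smul_right_injective _ (two_ne_zero (α := ℚ)) h
  have h3 : star ((⟨1/2, 1/2, 1/2, -1/2⟩ : ℍ[ℚ,((-1 : ℤ) : ℚ),((3 : ℤ) : ℚ)]) * ⟨1/2, 1/2, 1/2, -1/2⟩) * v *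
      ((⟨1/2, 1/2, 1/2, -1/2⟩ : ℍ[ℚ,((-1 : ℤ) : ℚ),((3 : ℤ) : ℚ)]) * ⟨1/2, 1/2, 1/2, -1/2⟩) = x' := by
    rw [mul_assoc, h2, ← mul_assoc, e_sq_mul_star_and.2, one_mul]
  rw [h3]
  exact hx'

/-- `nr u = 1` as `uū = 1`. [folklore] -/
private theorem mul_star_eq_one_of_re₇ {u : ℍ[ℚ,((-1 : ℤ) : ℚ),((3 : ℤ) : ℚ)]} (hn : (u * star u).re = 1) :
    u * star u = 1 := by
  rw [QuaternionAlgebra.mul_star_eq_coe, hn, QuaternionAlgebra.coe_one]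

/-- **THREE SHEETS: if every `w ∈ Γ₆` commuting with `x̂` lies in `𝔬`, then `x̂, x̂^σ, x̂^{σσ}` are PAIRWISE NOT `Γ`-CONJUGATE**
(`Γ = 𝔬¹`): a `v ∈ Γ` with `vx̂ = x̂^σv = (e²x̂ē²)v` puts `ē²v ∈ Γ₆` in the stabiliser of `x̂`, so `ē²v ∈ 𝔬` and `ē² ∈ 𝔬` —
false; likewise `ē²ē² ∉ 𝔬` for `(x̂, x̂^{σσ})`; and `(x̂^σ, x̂^{σσ})` is carried to `(x̂, x̂^σ)` by `Ad(ē²)`, which maps `Γ` to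
`Γ`. Over such a point of `Z(t)`, Lang's curve has three distinct points (`e_x ∈ {2, 4}`: the stabiliser is `{±1}` or
`ℤ[i]^× ⊂ 𝔬`). [cite: BayerTravesa2007, §1 Thm. 1.1 («`P₆` … elliptic of order `2`» — `P₆ ≢ P₅`) and Table 1] [cite: KudlaRapoportYang2006, §3.4 (3.4.14) («`e_x`»)] [cite: Lang1982AbelianFunctions, Ch. IX §5] -/
theorem sigma_classes_pairwise_not_order_conj (x : Fin 3 → ℤ)
    (HS : ∀ w : ℍ[ℚ,((-1 : ℤ) : ℚ),((3 : ℤ) : ℚ)], (w ∈ order (-1) 3 ∨ w - ⟨1/2, 1/2, 1/2, -1/2⟩ ∈ order (-1) 3) →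
      (w * star w).re = 1 → w * ⟨0, x 0, x 1, x 2⟩ = ⟨0, x 0, x 1, x 2⟩ * w → w ∈ order (-1) 3) :
    (∀ v ∈ order (-1) 3, (v * star v).re = 1 →
        v * ⟨0, x 0, x 1, x 2⟩ ≠ ⟨0, 4 * x 0 - 6 * x 1 - 3 * x 2, -x 0 + 2 * x 1, -2 * x 0 + 3 * x 1 + 2 * x 2⟩ * v) ∧
    (∀ v ∈ order (-1) 3, (v * star v).re = 1 →
        v * ⟨0, x 0, x 1, x 2⟩
          ≠ ⟨0, 28 * x 0 - 45 * x 1 - 18 * x 2, -6 * x 0 + 10 * x 1 + 3 * x 2, -15 * x 0 + 24 * x 1 + 10 * x 2⟩ * v) ∧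
    (∀ v ∈ order (-1) 3, (v * star v).re = 1 →
        v * ⟨0, 4 * x 0 - 6 * x 1 - 3 * x 2, -x 0 + 2 * x 1, -2 * x 0 + 3 * x 1 + 2 * x 2⟩
          ≠ ⟨0, 28 * x 0 - 45 * x 1 - 18 * x 2, -6 * x 0 + 10 * x 1 + 3 * x 2, -15 * x 0 + 24 * x 1 + 10 * x 2⟩ * v) := by
  set E2 := (⟨1/2, 1/2, 1/2, -1/2⟩ : ℍ[ℚ,((-1 : ℤ) : ℚ),((3 : ℤ) : ℚ)]) * ⟨1/2, 1/2, 1/2, -1/2⟩ with hE2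
  set X : ℍ[ℚ,((-1 : ℤ) : ℚ),((3 : ℤ) : ℚ)] := ⟨0, x 0, x 1, x 2⟩ with hX
  set Xs : ℍ[ℚ,((-1 : ℤ) : ℚ),((3 : ℤ) : ℚ)] :=
    ⟨0, 4 * x 0 - 6 * x 1 - 3 * x 2, -x 0 + 2 * x 1, -2 * x 0 + 3 * x 1 + 2 * x 2⟩ with hXs
  set Xss : ℍ[ℚ,((-1 : ℤ) : ℚ),((3 : ℤ) : ℚ)] :=
    ⟨0, 28 * x 0 - 45 * x 1 - 18 * x 2, -6 * x 0 + 10 * x 1 + 3 * x 2, -15 * x 0 + 24 * x 1 + 10 * x 2⟩ with hXss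
  have h1 : E2 * X = Xs * E2 := by rw [hE2, hX, hXs]; exact e_sq_mul_pureVec _ _ _
  have h2 : E2 * E2 * X = Xss * (E2 * E2) := by rw [hE2, hX, hXss]; exact e_sq_e_sq_mul_pureVec _ _ _
  have hss : star E2 * Xss = Xs * star E2 := by rw [hE2, hXs, hXss]; exact star_e_sq_mul_pureVec_sigma _ _ _
  have hs1 : E2 * star E2 = 1 := by rw [hE2]; exact e_sq_mul_star_and.1
  have hs2 : star E2 * E2 = 1 := by rw [hE2]; exact e_sq_mul_star_and.2
  have hO : E2 ∈ order (-1) 3 ∨ E2 - ⟨1/2, 1/2, 1/2, -1/2⟩ ∈ order (-1) 3 := by rw [hE2]; exact e_sq_maxOrder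
  have hOs : star E2 ∈ order (-1) 3 ∨ star E2 - ⟨1/2, 1/2, 1/2, -1/2⟩ ∈ order (-1) 3 := star_maxOrder hO
  have hnE : (E2 * star E2).re = 1 := by rw [hs1, QuaternionAlgebra.re_one]
  have hnEs : (star E2 * star (star E2)).re = 1 := by rw [star_star, hs2, QuaternionAlgebra.re_one]
  have hnotS : star E2 ∉ order (-1) 3 := by rw [hE2]; exact e_sq_not_mem_order'.2.1
  have hnotSS : star (E2 * E2) ∉ order (-1) 3 := by rw [hE2]; exact e_sq_not_mem_order'.2.2.2
  -- conjugation forms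
  have hc1 : E2 * X * star E2 = Xs := by rw [h1, mul_assoc, hs1, mul_one]
  have hc2 : E2 * E2 * X * (star E2 * star E2) = Xss := by
    rw [h2, mul_assoc, mul_assoc E2, ← mul_assoc E2 (star E2), hs1, one_mul, hs1, mul_one]
  -- (a) `x̂` vs `x̂^σ`
  have ha : ∀ v ∈ order (-1) 3, (v * star v).re = 1 → v * X ≠ Xs * v := by
    intro v hv hvn h
    have hv1 : v * star v = 1 := mul_star_eq_one_of_re₇ hvn
    have hw : (star E2 * v) * X = X * (star E2 * v) := by
      calc star E2 * v * X = star E2 * (v * X) := mul_assoc _ _ _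
        _ = star E2 * (E2 * X * star E2 * v) := by rw [h, hc1]
        _ = (star E2 * E2) * X * (star E2 * v) := by simp only [mul_assoc]
        _ = X * (star E2 * v) := by rw [hs2, one_mul]
    have hwn : ((star E2 * v) * star (star E2 * v)).re = 1 := by rw [re_mul_mul_star_mul, hnEs, hvn, mul_one]
    have hwo : star E2 * v ∈ order (-1) 3 := HS _ (maxOrder_mul hOs (Or.inl hv)) hwn hw
    have hmem : star E2 * v * star v ∈ order (-1) 3 := Subring.mul_mem _ hwo (star_mem_order hv)
    rw [mul_assoc, hv1, mul_one] at hmem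
    exact hnotS hmem
  refine ⟨ha, ?_, ?_⟩
  · -- (b) `x̂` vs `x̂^{σσ}`
    intro v hv hvn h
    have hv1 : v * star v = 1 := mul_star_eq_one_of_re₇ hvn
    have hs2' : star E2 * star E2 * (E2 * E2) = 1 := by
      rw [mul_assoc, ← mul_assoc (star E2) E2, hs2, one_mul, hs2]
    have hw : (star E2 * star E2 * v) * X = X * (star E2 * star E2 * v) := by
      calc star E2 * star E2 * v * X = star E2 * star E2 * (v * X) := mul_assoc _ _ _
        _ = star E2 * star E2 * (E2 * E2 * X * (star E2 * star E2) * v) := by rw [h, hc2]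
        _ = (star E2 * star E2 * (E2 * E2)) * X * (star E2 * star E2 * v) := by simp only [mul_assoc]
        _ = X * (star E2 * star E2 * v) := by rw [hs2', one_mul]
    have hwn : ((star E2 * star E2 * v) * star (star E2 * star E2 * v)).re = 1 := by
      rw [re_mul_mul_star_mul, re_mul_mul_star_mul, hnEs, hvn, mul_one, mul_one]
    have hwo : star E2 * star E2 * v ∈ order (-1) 3 :=
      HS _ (maxOrder_mul (maxOrder_mul hOs hOs) (Or.inl hv)) hwn hw
    have hmem : star E2 * star E2 * v * star v ∈ order (-1) 3 := Subring.mul_mem _ hwo (star_mem_order hv)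
    rw [mul_assoc, hv1, mul_one, ← star_mul] at hmem
    exact hnotSS hmem
  · -- (c) `x̂^σ` vs `x̂^{σσ}`: conjugate back by `Ad(ē²)`
    intro v hv hvn h
    have hw𝔬 : star E2 * v * E2 ∈ order (-1) 3 := by rw [hE2]; exact star_e_sq_mul_mul_e_sq_mem_order hv
    have hwn : ((star E2 * v * E2) * star (star E2 * v * E2)).re = 1 := by
      rw [re_mul_mul_star_mul, re_mul_mul_star_mul, hnEs, hvn, hnE, mul_one, mul_one]
    refine ha _ hw𝔬 hwn ?_
    calc star E2 * v * E2 * X = star E2 * v * (E2 * X) := mul_assoc _ _ _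
      _ = star E2 * v * (Xs * E2) := by rw [h1]
      _ = star E2 * (v * Xs) * E2 := by simp only [mul_assoc]
      _ = star E2 * (Xss * v) * E2 := by rw [h]
      _ = (star E2 * Xss) * v * E2 := by simp only [mul_assoc]
      _ = Xs * (star E2 * v * E2) := by rw [hss]; simp only [mul_assoc]

end Sheets

/-! ## §4 Which vectors: primitive norm `≠ 3` (three sheets) versus `= 3` (one sheet) -/

section Which

/-- An integer multiple of a pure vector in coordinates: `c·p̂`. [cite: KudlaRapoportYang2006, §3.4 (3.4.8)] -/
private theorem pureVec_intMul (c : ℤ) (p : Fin 3 → ℤ) :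
    (⟨0, ((c * p 0 : ℤ) : ℚ), ((c * p 1 : ℤ) : ℚ), ((c * p 2 : ℤ) : ℚ)⟩ : ℍ[ℚ,((-1 : ℤ) : ℚ),((3 : ℤ) : ℚ)])
      = (c : ℚ) • ⟨0, p 0, p 1, p 2⟩ := by
  rw [QuaternionAlgebra.smul_mk]
  simp only [smul_eq_mul, mul_zero, Int.cast_mul]

/-- **THE STABILISER LIES IN `𝔬` for `x̂ = c·p̂`, `c ≠ 0`, `p̂` primitive with `Q(p̂) > 0`, `Q(p̂) ≠ 3`** (hypothesis of §3):
by g31-#8 the `Γ₆`-stabiliser of `p̂` — which is that of `c·p̂` — is `{±1}` (`Q(p̂) > 1`, both residues mod `4`) or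
`{±1, ±p̂}` (`Q(p̂) = 1`), all in `𝔬`. [cite: KudlaRapoportYang2006, §3.4 (3.4.6) («`w(c²d)`») and (3.4.14) («`e_x`»)] [cite: BayerTravesa2007, §1 Thm. 1.1] -/
theorem stabiliser_subset_order_of_primitive_norm_ne_three {p : Fin 3 → ℤ}
    (hprim : ∃ w : Fin 3 → ℤ, ∑ k, w k * p k = 1) (ht0 : 0 < p 0 ^ 2 - 3 * p 1 ^ 2 - 3 * p 2 ^ 2)
    (ht3 : p 0 ^ 2 - 3 * p 1 ^ 2 - 3 * p 2 ^ 2 ≠ 3) {c : ℤ} (hc : c ≠ 0) :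
    ∀ w : ℍ[ℚ,((-1 : ℤ) : ℚ),((3 : ℤ) : ℚ)], (w ∈ order (-1) 3 ∨ w - ⟨1/2, 1/2, 1/2, -1/2⟩ ∈ order (-1) 3) →
      (w * star w).re = 1 →
      w * ⟨0, ((c * p 0 : ℤ) : ℚ), ((c * p 1 : ℤ) : ℚ), ((c * p 2 : ℤ) : ℚ)⟩
        = ⟨0, ((c * p 0 : ℤ) : ℚ), ((c * p 1 : ℤ) : ℚ), ((c * p 2 : ℤ) : ℚ)⟩ * w →
      w ∈ order (-1) 3 := by
  intro w hw hwn hcomm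
  rw [pureVec_intMul, mul_smul_comm, smul_mul_assoc] at hcomm
  have hcomm' : w * ⟨0, p 0, p 1, p 2⟩ = ⟨0, p 0, p 1, p 2⟩ * w :=
    smul_right_injective _ (by exact_mod_cast hc : (c : ℚ) ≠ 0) hcomm
  have h1mem : (1 : ℍ[ℚ,((-1 : ℤ) : ℚ),((3 : ℤ) : ℚ)]) ∈ order (-1) 3 := Subring.one_mem _
  by_cases h1 : p 0 ^ 2 - 3 * p 1 ^ 2 - 3 * p 2 ^ 2 = 1
  · obtain ⟨r, s, rfl, hrs⟩ := (maxOrder_normOne_commute_iff_of_norm_one hprim h1 w).1 ⟨hw, hwn, hcomm'⟩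
    rcases hrs with ⟨rfl, rfl⟩ | ⟨rfl, rfl⟩ | ⟨rfl, rfl⟩ | ⟨rfl, rfl⟩
    · exact (coe_add_smul_mem_order_iff hprim _ _).2 ⟨⟨1, by norm_num⟩, ⟨0, by norm_num⟩⟩
    · exact (coe_add_smul_mem_order_iff hprim _ _).2 ⟨⟨-1, by norm_num⟩, ⟨0, by norm_num⟩⟩
    · exact (coe_add_smul_mem_order_iff hprim _ _).2 ⟨⟨0, by norm_num⟩, ⟨1, by norm_num⟩⟩
    · exact (coe_add_smul_mem_order_iff hprim _ _).2 ⟨⟨0, by norm_num⟩, ⟨-1, by norm_num⟩⟩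
  have hgt1 : 1 < p 0 ^ 2 - 3 * p 1 ^ 2 - 3 * p 2 ^ 2 := by omega
  by_cases h4 : (p 0 ^ 2 - 3 * p 1 ^ 2 - 3 * p 2 ^ 2) % 4 = 3
  · have hgt3 : 3 < p 0 ^ 2 - 3 * p 1 ^ 2 - 3 * p 2 ^ 2 := by omega
    rcases (maxOrder_normOne_commute_iff_of_three_mod_four hprim h4 hgt3 w).1 ⟨hw, hwn, hcomm'⟩ with rfl | rfl
    · exact h1mem
    · exact Subring.neg_mem _ h1mem
  · rcases (maxOrder_normOne_commute_iff_generic hprim h4 hgt1 w).1 ⟨hw, hwn, hcomm'⟩ with rfl | rfl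
    · exact h1mem
    · exact Subring.neg_mem _ h1mem

/-- **THREE DISTINCT `Γ`-CLASSES IN THE `Γ₆`-CLASS OF `x̂ = c·p̂`** (`c ≠ 0`, `p̂` primitive, `Q(p̂) > 0`, `Q(p̂) ≠ 3`):
`x̂, x̂^σ, x̂^{σσ}` are pairwise not `𝔬¹`-conjugate — Lang's curve has three points over this point of `Z(c²Q(p̂))`.
[cite: BayerTravesa2007, §1 Thm. 1.1 and Table 1] [cite: KudlaRapoportYang2006, §3.4 (3.4.14)] [cite: Lang1982AbelianFunctions, Ch. IX §5] -/
theorem three_sheets_of_primitive_norm_ne_three {p : Fin 3 → ℤ}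
    (hprim : ∃ w : Fin 3 → ℤ, ∑ k, w k * p k = 1) (ht0 : 0 < p 0 ^ 2 - 3 * p 1 ^ 2 - 3 * p 2 ^ 2)
    (ht3 : p 0 ^ 2 - 3 * p 1 ^ 2 - 3 * p 2 ^ 2 ≠ 3) {c : ℤ} (hc : c ≠ 0) {x : Fin 3 → ℤ} (hx : ∀ k, x k = c * p k) :
    (∀ v ∈ order (-1) 3, (v * star v).re = 1 →
        v * ⟨0, x 0, x 1, x 2⟩ ≠ ⟨0, 4 * x 0 - 6 * x 1 - 3 * x 2, -x 0 + 2 * x 1, -2 * x 0 + 3 * x 1 + 2 * x 2⟩ * v) ∧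
    (∀ v ∈ order (-1) 3, (v * star v).re = 1 →
        v * ⟨0, x 0, x 1, x 2⟩
          ≠ ⟨0, 28 * x 0 - 45 * x 1 - 18 * x 2, -6 * x 0 + 10 * x 1 + 3 * x 2, -15 * x 0 + 24 * x 1 + 10 * x 2⟩ * v) ∧
    (∀ v ∈ order (-1) 3, (v * star v).re = 1 →
        v * ⟨0, 4 * x 0 - 6 * x 1 - 3 * x 2, -x 0 + 2 * x 1, -2 * x 0 + 3 * x 1 + 2 * x 2⟩
          ≠ ⟨0, 28 * x 0 - 45 * x 1 - 18 * x 2, -6 * x 0 + 10 * x 1 + 3 * x 2, -15 * x 0 + 24 * x 1 + 10 * x 2⟩ * v) := by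
  have hx' : x = fun k ↦ c * p k := funext hx
  subst hx'
  exact sigma_classes_pairwise_not_order_conj (fun k ↦ c * p k)
    (stabiliser_subset_order_of_primitive_norm_ne_three hprim ht0 ht3 hc)

/-- **ONE SHEET OVER THE `Z(3)`-POINTS: for `p̂` primitive with `Q(p̂) = 3`, the vectors `p̂^σ` and `p̂^{σσ}` ARE
`Γ`-conjugate to `p̂`** (`Γ = 𝔬¹`): the unit `s = (1 + p̂)/2 ∈ Γ₆` (g31-#4 `half_one_add_maxOrder_iff`; `ss̄ = (1 + 3)/4 =
1`) commutes with `p̂` and is NOT in `𝔬`, so `s ∈ Γe²` or `s ∈ Γe²e²` (g30-#4's trichotomy), and so is `s̄`, in the other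
coset; unwinding gives `v·p̂^σ = p̂·v` and `v'·p̂^{σσ} = p̂·v'` with `v, v' ∈ Γ` (using `e⁶ ∈ 𝔬` and `Ad(ē²)(𝔬) = 𝔬`). Over the
order-`3` elliptic points `P₂, P₄` of `X₆` (`e_x = 6`) Lang's curve has a single point: the triple cover is totally
ramified there (cf. g30-#3 `στ₃ ≅_ρ τ₃`). [cite: BayerTravesa2007, §1 Thm. 1.1 («the remaining vertices `P₂, P₄` are elliptic of order `3`»)] [cite: KudlaRapoportYang2006, §3.4 (3.4.6) («`w(c²d)`», here `w(−3) = 6`) and (3.4.14)] [cite: Lang1982AbelianFunctions, Ch. IX §5] -/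
theorem sigma_classes_merge_of_norm_three {p : Fin 3 → ℤ} (ht : p 0 ^ 2 - 3 * p 1 ^ 2 - 3 * p 2 ^ 2 = 3) :
    (∃ v ∈ order (-1) 3, (v * star v).re = 1 ∧
        v * ⟨0, 4 * p 0 - 6 * p 1 - 3 * p 2, -p 0 + 2 * p 1, -2 * p 0 + 3 * p 1 + 2 * p 2⟩ = ⟨0, p 0, p 1, p 2⟩ * v) ∧
    (∃ v ∈ order (-1) 3, (v * star v).re = 1 ∧
        v * ⟨0, 28 * p 0 - 45 * p 1 - 18 * p 2, -6 * p 0 + 10 * p 1 + 3 * p 2, -15 * p 0 + 24 * p 1 + 10 * p 2⟩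
          = ⟨0, p 0, p 1, p 2⟩ * v) := by
  set E2 := (⟨1/2, 1/2, 1/2, -1/2⟩ : ℍ[ℚ,((-1 : ℤ) : ℚ),((3 : ℤ) : ℚ)]) * ⟨1/2, 1/2, 1/2, -1/2⟩ with hE2
  set X : ℍ[ℚ,((-1 : ℤ) : ℚ),((3 : ℤ) : ℚ)] := ⟨0, p 0, p 1, p 2⟩ with hX
  set Xs : ℍ[ℚ,((-1 : ℤ) : ℚ),((3 : ℤ) : ℚ)] :=
    ⟨0, 4 * p 0 - 6 * p 1 - 3 * p 2, -p 0 + 2 * p 1, -2 * p 0 + 3 * p 1 + 2 * p 2⟩ with hXs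
  set Xss : ℍ[ℚ,((-1 : ℤ) : ℚ),((3 : ℤ) : ℚ)] :=
    ⟨0, 28 * p 0 - 45 * p 1 - 18 * p 2, -6 * p 0 + 10 * p 1 + 3 * p 2, -15 * p 0 + 24 * p 1 + 10 * p 2⟩ with hXss
  have hsX : star E2 * Xs = X * star E2 := by rw [hE2, hX, hXs]; exact star_e_sq_mul_pureVec _ _ _
  have hss : star E2 * Xss = Xs * star E2 := by rw [hE2, hXs, hXss]; exact star_e_sq_mul_pureVec_sigma _ _ _
  have hs1 : E2 * star E2 = 1 := by rw [hE2]; exact e_sq_mul_star_and.1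
  have hs2 : star E2 * E2 = 1 := by rw [hE2]; exact e_sq_mul_star_and.2
  have hnE : (E2 * star E2).re = 1 := by rw [hs1, QuaternionAlgebra.re_one]
  have hnEs : (star E2 * star (star E2)).re = 1 := by rw [star_star, hs2, QuaternionAlgebra.re_one]
  have hE6 : E2 * E2 * E2 ∈ order (-1) 3 := by
    have h : E2 * E2 * E2 = ((⟨1/2, 1/2, 1/2, -1/2⟩ : ℍ[ℚ,((-1 : ℤ) : ℚ),((3 : ℤ) : ℚ)]) * ⟨1/2, 1/2, 1/2, -1/2⟩ *
        ⟨1/2, 1/2, 1/2, -1/2⟩) * ((⟨1/2, 1/2, 1/2, -1/2⟩ : ℍ[ℚ,((-1 : ℤ) : ℚ),((3 : ℤ) : ℚ)]) * ⟨1/2, 1/2, 1/2, -1/2⟩ *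
        ⟨1/2, 1/2, 1/2, -1/2⟩) := by
      rw [hE2]; simp only [mul_assoc]
    rw [h, e_cube.1]
    exact Subring.mul_mem _ e_cube.2.1 e_cube.2.1
  have hAd : ∀ v ∈ order (-1) 3, star E2 * v * E2 ∈ order (-1) 3 := fun v hv ↦ by
    rw [hE2]; exact star_e_sq_mul_mul_e_sq_mem_order hv
  -- the unit `s = (1 + p̂)/2`
  set s : ℍ[ℚ,((-1 : ℤ) : ℚ),((3 : ℤ) : ℚ)] := (1/2 : ℚ) • (1 + ⟨0, p 0, p 1, p 2⟩) with hs_def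
  have hsO : s ∈ order (-1) 3 ∨ s - ⟨1/2, 1/2, 1/2, -1/2⟩ ∈ order (-1) 3 :=
    (half_one_add_maxOrder_iff p).2 (by rw [ht]; decide)
  have hs𝔬 : s ∉ order (-1) 3 := half_one_add_not_mem_order p
  have hs_eq : s = ⟨1/2, (p 0 : ℚ) / 2, (p 1 : ℚ) / 2, (p 2 : ℚ) / 2⟩ := by
    have h1 : (1 : ℍ[ℚ,((-1 : ℤ) : ℚ),((3 : ℤ) : ℚ)]) = ⟨1, 0, 0, 0⟩ := rfl
    rw [hs_def, h1, QuaternionAlgebra.mk_add_mk, QuaternionAlgebra.smul_mk]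
    ext <;> simp only [smul_eq_mul] <;> ring
  have ht' : ((p 0 : ℚ)) ^ 2 - 3 * (p 1 : ℚ) ^ 2 - 3 * (p 2 : ℚ) ^ 2 = 3 := by exact_mod_cast ht
  have hsn : (s * star s).re = 1 := by
    rw [hs_eq, QuaternionAlgebra.star_mk, QuaternionAlgebra.mk_mul_mk]
    dsimp only
    push_cast
    linear_combination (1/4 : ℚ) * ht'
  have hsc : s * X = X * s := by
    rw [hs_def, hX, smul_mul_assoc, mul_smul_comm, add_mul, mul_add, one_mul, mul_one]
  have htO : star s ∈ order (-1) 3 ∨ star s - ⟨1/2, 1/2, 1/2, -1/2⟩ ∈ order (-1) 3 := star_maxOrder hsO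
  have htn : (star s * star (star s)).re = 1 := by rw [star_star, star_comm_self' s, hsn]
  have hXstar : star X = -X := by rw [hX]; exact QuaternionAlgebra.star_eq_neg.mpr rfl
  have htc : star s * X = X * star s := by
    have h := congrArg star hsc
    rw [star_mul, star_mul, hXstar, neg_mul, mul_neg, neg_inj] at h
    exact h.symm
  obtain ⟨v, hv, hvn, hcase⟩ := exists_order_normOne_mul_e_pow hsO hsn
  rw [← hE2] at hcase
  rcases hcase with hsv | hsv | hsv
  · exact absurd (hsv ▸ hv) hs𝔬
  · -- `s = ve²`: `v = sē²` conjugates `p̂^σ` to `p̂`; `s̄ = v'e²e²` with `v' = s̄ē²ē² ∈ Γ` conjugates `p̂^{σσ}` to `p̂`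
    have hv_eq : v = s * star E2 := by rw [hsv, mul_assoc, hs1, mul_one]
    refine ⟨⟨v, hv, hvn, ?_⟩, ⟨star s * star E2 * star E2, ?_, ?_, ?_⟩⟩
    · rw [hv_eq, mul_assoc, hsX, ← mul_assoc, hsc, mul_assoc]
    · -- membership: `s̄ē²ē² = (e²e²ve²)‾ = (e⁶·ē²ve²)‾`
      have h1 : star s * star E2 * star E2 = star (E2 * E2 * v * E2) := by
        rw [hsv]; simp only [star_mul, mul_assoc]
      have h2 : E2 * E2 * v * E2 = (E2 * E2 * E2) * (star E2 * v * E2) := by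
        calc E2 * E2 * v * E2 = E2 * E2 * (E2 * star E2) * v * E2 := by rw [hs1, mul_one]
          _ = (E2 * E2 * E2) * (star E2 * v * E2) := by simp only [mul_assoc]
      rw [h1, h2]
      exact star_mem_order (Subring.mul_mem _ hE6 (hAd v hv))
    · rw [re_mul_mul_star_mul, re_mul_mul_star_mul, htn, hnEs, mul_one, mul_one]
    · calc star s * star E2 * star E2 * Xss = star s * star E2 * (star E2 * Xss) := mul_assoc _ _ _
        _ = star s * star E2 * (Xs * star E2) := by rw [hss]
        _ = star s * (star E2 * Xs) * star E2 := by simp only [mul_assoc]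
        _ = star s * (X * star E2) * star E2 := by rw [hsX]
        _ = (star s * X) * star E2 * star E2 := by simp only [mul_assoc]
        _ = X * (star s * star E2 * star E2) := by rw [htc]; simp only [mul_assoc]
  · -- `s = ve²e²`: `v = sē²ē²` conjugates `p̂^{σσ}` to `p̂`; `s̄ē² ∈ Γ` conjugates `p̂^σ` to `p̂`
    have hv_eq : v = s * star E2 * star E2 := by
      rw [hsv, mul_assoc (v * E2), hs1, mul_one, mul_assoc, hs1, mul_one]
    refine ⟨⟨star s * star E2, ?_, ?_, ?_⟩, ⟨v, hv, hvn, ?_⟩⟩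
    · have h1 : star s * star E2 = star (E2 * v * E2 * E2) := by
        rw [hsv]; simp only [star_mul, mul_assoc]
      have h2 : E2 * v * E2 * E2 = (E2 * E2 * E2) * (star E2 * (star E2 * v * E2) * E2) := by
        calc E2 * v * E2 * E2 = E2 * (E2 * star E2) * v * E2 * E2 := by rw [hs1, mul_one]
          _ = E2 * E2 * (star E2 * v) * E2 * E2 := by simp only [mul_assoc]
          _ = E2 * E2 * (E2 * star E2) * (star E2 * v) * E2 * E2 := by rw [hs1, mul_one]
          _ = (E2 * E2 * E2) * (star E2 * (star E2 * v * E2) * E2) := by simp only [mul_assoc]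
      rw [h1, h2]
      exact star_mem_order (Subring.mul_mem _ hE6 (hAd _ (hAd v hv)))
    · rw [re_mul_mul_star_mul, htn, hnEs, mul_one]
    · calc star s * star E2 * Xs = star s * (star E2 * Xs) := mul_assoc _ _ _
        _ = star s * (X * star E2) := by rw [hsX]
        _ = (star s * X) * star E2 := (mul_assoc _ _ _).symm
        _ = X * (star s * star E2) := by rw [htc, mul_assoc]
    · calc v * Xss = s * star E2 * (star E2 * Xss) := by rw [hv_eq, mul_assoc]
        _ = s * star E2 * (Xs * star E2) := by rw [hss]
        _ = s * (star E2 * Xs) * star E2 := by simp only [mul_assoc]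
        _ = s * (X * star E2) * star E2 := by rw [hsX]
        _ = (s * X) * star E2 * star E2 := by simp only [mul_assoc]
        _ = X * v := by rw [hsc, hv_eq]; simp only [mul_assoc]

end Which

end Literature.Geometry.Kaehler.ComplexTorus.QuaternionType
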